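import Summits.QuantumFields.BalabanUV.Beta.GAN24.ThreeFaceUnrollOfLocal
import Summits.QuantumFields.BalabanUV.Beta.GAN24.SymLambdaPieceThreeFace
import Summits.QuantumFields.BalabanUV.Beta.GAN24.ThreeFaceRecClosed

/-!
# `BalabanUV.Beta.GAN24.CombThreeFaceRec` — binder row G-an2-4 ∕ (CONV-C), TRANSFER-III, the (III′) (C)-campaign's supplier `hB0` AT LEVELS `≥ 1`: **«3F-REC» AT THE COMB DATA** —
# at an1's record `symTablesAn1S2 d Lc cΛt` (`Lc` odd, `3 ≤ Lc`, centred root), for ALL pins `cE cVH cΛ`, EVERY level `j`, EVERY exit-face period `Lc^{k+1}` and all `(γ, α, β)`, the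
# three-face-legs cell form of the comb member `S̃comb_j = ScombOf tabs cE cVH cΛ j` AND of its transport `𝒯 S̃comb_j` VANISHES — leaf-04 g62∕g63's «3F-REC» chain
# (`ThreeFaceUnrollSrec` ⨾ `ThreeFaceRecOfLetters` ⨾ `ThreeFaceRecClosed.threeFace_wilsonA`) re-run on road-P2 M.43's bm reading of the comb S-recursion, the level-`j` transport REMOVED at
# each step by leaf-01 g87's exit-row blindness (`ThreeFaceUnrollOfLocal.threeFace_e3OfK_transport_ScombOf_unroll`), the Λ-pieces by the sym (T-H)_face (`SymLambdaPieceThreeFace`), the border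
# off the ff block (`symVhSAt_inl_inl`).
# (G-an2-4 CRUX TEAM (2), leaf prover `b2b-balaban-gan24-formalise-leaf-01`, gen 87; README-g87 §ROADMAP steps 1–2 DONE)

NOT IN PRINT; OUR BOOKKEEPING ([folklore] BY NAME; 0 `def`, 0 cited fact, 0 `def … : Prop`, 0 sorry).
HONEST FRAMING (cell contract, verbatim): «discharging `BetaPertH` makes Bałaban's UV stability UNCONDITIONAL — a real constructive-QFT result; it is NOT the continuum limit and NOT
the Clay problem.»  HONEST DEPENDENCY (verbatim): «continuum YM on T⁴ ⇐ BetaPertH ∧ nine spine estimates (0/9 proved); BetaPertH ⇐ (D1) ∧ (D4) ∧ CAP+tail; G-an2-4 gates asym, D1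
and NE2/3/4.»

## What is proved (generic `d`, `[NeZero Lc]`, an1's record, all `cΛt cE cVH cΛ`)
* §1 **`threeFace_ScombOf_succ_unroll`** (every `P ≥ 1`): `3F^{(P)}[S̃comb_{j+1}] = (cE·wE_{j+1})·cH_j³·3F^{(Lc·P)}[S̃comb_j] + (cΛ·wΛ_{j+1})·ΛF^{(P)}_{j+1}` (the Λ-piece displayed).
* §2 **`threeFace_ScombOf_zero`** (`Lc` odd, `3 ≤ Lc`, period `Lc^{k+1}`): the level-`0` form vanishes (Wilson (T-W)_face + sym Λ₀ (T-H)_face).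
* §3 **`threeFace_ScombOf_rec`**: «3F-REC» AT THE COMB — every `j`, every period `Lc^{k+1}`; **`threeFace_ScombOf_rec_Lc`** (period `Lc`); **`threeFace_transport_ScombOf_rec`** (the member `𝒯 S̃comb_j`).
WHAT THIS IS NOT: NOT «S3C-REC» at the comb (the slot-charge ∕ leg-charge read of «3F-REC», leaf-04's `SpureRecSlotChargeThreeFace ∕ SpureRecLegChargeThreeFace`, is the next port); NOT
(Z)_comb; NOT `hB0`; NEVER «G-an2-4 closed» as (CONV-C); NOT D1, NOT `BetaPertH`, NOT continuum, NOT Clay.  2026-08-27; no existing file touched.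
-/

noncomputable section

open Finset
open scoped BigOperators
open Literature.MathematicalPhysics.QuantumFieldTheory
open Literature.MathematicalPhysics.QuantumFieldTheory.Balaban1983to89
open Literature.MathematicalPhysics.QuantumFieldTheory.Balaban1983to89.Beta
open B12Sec2to5 (l1)
open ExpKernelCalculus (Site MKer BiLoc comp)
open AffineAveraging (box toSite)
open AveragingContoursRooted (ctr ctrOff ctrOff_mem_box)
open OneStepResolventKernel (Fib LocStencil KInv decays_KInv)
open OneStepKernelFamily (KInvStep)
open StepJetData (wilsonA wBound locStencil_wilsonA)
open BalabanStepJets (lamCoeffOf abs_lamCoeffOf_le)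
open BalabanStepJetsSucc (wE wVH wΛ lamCoeffK E2)
open InterLevelTransport (SLam locStencil_SLam)
open Summit.QuantumFields.BalabanUV.Beta.TameKernelCalculus (trK)
open Summit.QuantumFields.BalabanUV.Beta.AxialDressingRooted (coDressKBmAt decays_coDressKBmAt_KInvStep)
open Summit.QuantumFields.BalabanUV.Beta.BorderedHessian (stepScale)
open Summit.QuantumFields.BalabanUV.Beta.SpineRooted (e3OfK locStencil_e3OfK S0NOf)
open Summit.QuantumFields.BalabanUV.Beta.WardLocusRecursive (SrecOf_zero)
open Summit.QuantumFields.BalabanUV.Beta.SymAveragingHessianCounts (symVhSAt symVhSAt_inl_inl symHessFFAt)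
open Summit.QuantumFields.BalabanUV.Beta.SymSecondOrderTablesAn1 (symTablesAn1S2 symTablesAn1S2_V symTablesAn1S2_H)
open Summit.QuantumFields.BalabanUV.Beta.CombChartStepJets (ScombOf ScombOf_eq locStencil_ScombOf)
open Summit.QuantumFields.BalabanUV.Beta.SymCorrectorKernel (psiKS)
open Summit.QuantumFields.BalabanUV.Beta.SymCorrectorFace (slotPsiS)
open Summit.QuantumFields.BalabanUV.Beta.GAN24.CombCubicStepTransport (ScombOf_succ_eq_bm_transport)
open Summit.QuantumFields.BalabanUV.Beta.GAN24.CombTransportedBorder (pos_Lc)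
open Summit.QuantumFields.BalabanUV.Beta.GAN24.CombVHEWordsZeroStep (exists_locStencil_transport_ScombOf)
open Summit.QuantumFields.BalabanUV.Beta.GAN24.LambdaPieceThreeFace (summable_weighted_pairs)
open Summit.QuantumFields.BalabanUV.Beta.GAN24.LambdaSectorClassSlotOfTables (exists_locStencil_lamSectorK_of_tables exists_locStencil_lamSectorOf_of_tables)
open Summit.QuantumFields.BalabanUV.Beta.GAN24.ThreeFaceUnrollOfLocal (threeFace_e3OfK_transport_ScombOf_unroll)
open Summit.QuantumFields.BalabanUV.Beta.GAN24.SymLambdaPieceThreeFace (threeFace_SLam_lamCoeffK_sym_eq_zero threeFace_SLam_lamCoeffOf_sym_eq_zero)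
open Summit.QuantumFields.BalabanUV.Beta.GAN24.ExitFaceWeightTransport (threeFace_transport_eq)
open Summit.QuantumFields.BalabanUV.Beta.GAN24.ThreeFaceRecClosed (threeFace_wilsonA)

namespace Summit.QuantumFields.BalabanUV.Beta.GAN24.CombThreeFaceRec

variable {d : ℕ} {Lc : ℕ} [NeZero Lc]

/-! ## §1 The unrolling identity at the level of the comb member -/

/-- NOT IN PRINT; OUR BOOKKEEPING ([folklore]; **THE COMB UNROLLING IDENTITY**).  At an1's record, all pins, every `j`, every `P ≥ 1`, all `(γ, α, β)`: the three-face-legs cell form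
(period `P`) of `S̃comb_{j+1}` splits along M.43 `ScombOf_succ_eq_bm_transport` — E-sector (unrolled by `threeFace_e3OfK_transport_ScombOf_unroll` to `(cE·wE_{j+1})·cH_j³·3F^{(Lc·P)}[S̃comb_j]`,
transport gone), border (OFF the ff block), Λ-piece (displayed). -/
theorem threeFace_ScombOf_succ_unroll (cΛt cE cVH cΛ : ℝ) (j : ℕ) (γ α β : Fin (d + 1)) (P : ℕ) [NeZero P] :
    (∑ v ∈ box (d + 1) P, (if toSite v γ % (P : ℤ) = (P : ℤ) - 1 then (1 : ℝ) else 0) *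
        ∑' yw : Site (d + 1) × Site (d + 1),
          (if yw.1 α % (P : ℤ) = (P : ℤ) - 1 then (1 : ℝ) else 0) * (if yw.2 β % (P : ℤ) = (P : ℤ) - 1 then (1 : ℝ) else 0) *
            ScombOf (symTablesAn1S2 d Lc cΛt) cE cVH cΛ (j + 1) γ (toSite v) yw.1 yw.2 (Sum.inl α) (Sum.inl β))
      = (cE * wE d Lc (j + 1)) * ((stepScale d Lc j * (Lc : ℝ) ^ (d + 1))⁻¹) ^ 3 *
          (∑ τ ∈ box (d + 1) (Lc * P), (if toSite τ γ % ((Lc * P : ℕ) : ℤ) = ((Lc * P : ℕ) : ℤ) - 1 then (1 : ℝ) else 0) *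
            ∑' st : Site (d + 1) × Site (d + 1),
              (if st.1 α % ((Lc * P : ℕ) : ℤ) = ((Lc * P : ℕ) : ℤ) - 1 then (1 : ℝ) else 0) *
                (if st.2 β % ((Lc * P : ℕ) : ℤ) = ((Lc * P : ℕ) : ℤ) - 1 then (1 : ℝ) else 0) *
                ScombOf (symTablesAn1S2 d Lc cΛt) cE cVH cΛ j γ (toSite τ) st.1 st.2 (Sum.inl α) (Sum.inl β))
        + (cΛ * wΛ d Lc (j + 1)) *
          (∑ v ∈ box (d + 1) P, (if toSite v γ % (P : ℤ) = (P : ℤ) - 1 then (1 : ℝ) else 0) *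
            ∑' yw : Site (d + 1) × Site (d + 1),
              (if yw.1 α % (P : ℤ) = (P : ℤ) - 1 then (1 : ℝ) else 0) * (if yw.2 β % (P : ℤ) = (P : ℤ) - 1 then (1 : ℝ) else 0) *
                SLam Lc (lamCoeffK (KInvStep (d := d) Lc (j + 1)) (E2 d Lc (j + 1)) Lc) (fun μ y => symHessFFAt (ctr (d + 1) Lc) Lc μ y)
                  γ (toSite v) yw.1 yw.2 (Sum.inl α) (Sum.inl β)) := by
  have hLc : 1 ≤ Lc := Nat.one_le_iff_ne_zero.mpr (NeZero.ne Lc)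
  set w2 : Site (d + 1) × Site (d + 1) → ℝ := fun yw =>
    (if yw.1 α % (P : ℤ) = (P : ℤ) - 1 then (1 : ℝ) else 0) * (if yw.2 β % (P : ℤ) = (P : ℤ) - 1 then (1 : ℝ) else 0) with hw2
  have hw2b : ∀ yw, |w2 yw| ≤ 1 := by
    intro yw; simp only [hw2]; split_ifs <;> simp
  -- local-stencil data: the E-sector of `S̃comb_{j+1}` (re-spelled at the comb root) and the Λ-piece
  obtain ⟨CM, δM, hδM, hM⟩ := exists_locStencil_transport_ScombOf (d := d) (Lc := Lc) cΛt cE cVH cΛ j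
  obtain ⟨C3, δ3, hδ3, hE3⟩ := locStencil_e3OfK (N := Lc) hLc (decays_coDressKBmAt_KInvStep (d := d) (ctrOff_mem_box (pos_Lc (Lc := Lc))) j) hM hδM
  have hE3' : LocStencil (e3OfK Lc (coDressKBmAt (ctr (d + 1) Lc) Lc (KInvStep (d := d) Lc j))
      (fun κ u => comp (comp (trK (psiKS (ctrOff (d + 1) Lc) Lc)) (slotPsiS (ctrOff (d + 1) Lc) Lc (ScombOf (symTablesAn1S2 d Lc cΛt) cE cVH cΛ j) κ u))
        (psiKS (ctrOff (d + 1) Lc) Lc))) C3 δ3 := hE3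
  obtain ⟨CL, δL, hδL, hL⟩ := exists_locStencil_lamSectorK_of_tables (d := d) (Lc := Lc) (symTablesAn1S2 d Lc cΛt).hH j
  have hL' : LocStencil (SLam Lc (lamCoeffK (KInvStep (d := d) Lc (j + 1)) (E2 d Lc (j + 1)) Lc) (fun μ y => symHessFFAt (ctr (d + 1) Lc) Lc μ y)) CL δL := hL
  have key : ∀ v : Fin (d + 1) → ℕ,
      (∑' yw : Site (d + 1) × Site (d + 1), w2 yw * ScombOf (symTablesAn1S2 d Lc cΛt) cE cVH cΛ (j + 1) γ (toSite v) yw.1 yw.2 (Sum.inl α) (Sum.inl β))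
        = (cE * wE d Lc (j + 1)) * (∑' yw : Site (d + 1) × Site (d + 1),
            w2 yw * e3OfK Lc (coDressKBmAt (ctr (d + 1) Lc) Lc (KInvStep (d := d) Lc j))
              (fun κ u => comp (comp (trK (psiKS (ctrOff (d + 1) Lc) Lc)) (slotPsiS (ctrOff (d + 1) Lc) Lc (ScombOf (symTablesAn1S2 d Lc cΛt) cE cVH cΛ j) κ u))
                (psiKS (ctrOff (d + 1) Lc) Lc)) γ (toSite v) yw.1 yw.2 (Sum.inl α) (Sum.inl β))
          + (cΛ * wΛ d Lc (j + 1)) * (∑' yw : Site (d + 1) × Site (d + 1),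
            w2 yw * SLam Lc (lamCoeffK (KInvStep (d := d) Lc (j + 1)) (E2 d Lc (j + 1)) Lc) (fun μ y => symHessFFAt (ctr (d + 1) Lc) Lc μ y)
              γ (toSite v) yw.1 yw.2 (Sum.inl α) (Sum.inl β)) := by
    intro v
    have hsE := summable_weighted_pairs (hE3' γ (toSite v)) hδ3 (Sum.inl α) (Sum.inl β) w2 hw2b
    have hsL := summable_weighted_pairs (hL' γ (toSite v)) hδL (Sum.inl α) (Sum.inl β) w2 hw2b
    -- pointwise split along M.43 (the border is off the ff block)
    have hpt : ∀ yw : Site (d + 1) × Site (d + 1),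
        w2 yw * ScombOf (symTablesAn1S2 d Lc cΛt) cE cVH cΛ (j + 1) γ (toSite v) yw.1 yw.2 (Sum.inl α) (Sum.inl β)
          = (cE * wE d Lc (j + 1)) * (w2 yw * e3OfK Lc (coDressKBmAt (ctr (d + 1) Lc) Lc (KInvStep (d := d) Lc j))
              (fun κ u => comp (comp (trK (psiKS (ctrOff (d + 1) Lc) Lc)) (slotPsiS (ctrOff (d + 1) Lc) Lc (ScombOf (symTablesAn1S2 d Lc cΛt) cE cVH cΛ j) κ u))
                (psiKS (ctrOff (d + 1) Lc) Lc)) γ (toSite v) yw.1 yw.2 (Sum.inl α) (Sum.inl β))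
            + (cΛ * wΛ d Lc (j + 1)) * (w2 yw * SLam Lc (lamCoeffK (KInvStep (d := d) Lc (j + 1)) (E2 d Lc (j + 1)) Lc)
              (fun μ y => symHessFFAt (ctr (d + 1) Lc) Lc μ y) γ (toSite v) yw.1 yw.2 (Sum.inl α) (Sum.inl β)) := by
      intro yw
      rw [ScombOf_succ_eq_bm_transport]
      simp only [Pi.add_apply, Pi.smul_apply, smul_eq_mul, symTablesAn1S2_V, symTablesAn1S2_H, symVhSAt_inl_inl, mul_zero, add_zero]
      ring
    rw [tsum_congr hpt, ((hsE.mul_left _)).tsum_add (hsL.mul_left _), tsum_mul_left, tsum_mul_left]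
  have hU := threeFace_e3OfK_transport_ScombOf_unroll (d := d) (Lc := Lc) cΛt cE cVH cΛ j γ α β P
  simp only [hw2] at key
  rw [Finset.sum_congr rfl fun v _ => by rw [key v]]
  simp only [mul_add, Finset.sum_add_distrib]
  congr 1
  · rw [mul_assoc, ← hU, Finset.mul_sum]
    exact Finset.sum_congr rfl fun v _ => by ring
  · rw [Finset.mul_sum]
    exact Finset.sum_congr rfl fun v _ => by ring

/-! ## §2 The level-`0` member -/

/-- NOT IN PRINT; OUR BOOKKEEPING ([folklore]; **(T-0)_face AT THE COMB**).  At an1's record with `Lc` odd and `3 ≤ Lc`: the three-face-legs cell form (period `Lc^{k+1}`) of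
`S̃comb_0 = S0NOf V H` vanishes — the cubic Wilson table by leaf-04's (T-W)_face `ThreeFaceRecClosed.threeFace_wilsonA`, the border off the ff block, the Λ₀-piece by the sym (T-H)_face. -/
theorem threeFace_ScombOf_zero (hLo : Odd Lc) (hLc3 : 3 ≤ Lc) (cΛt cE cVH cΛ : ℝ) (k : ℕ) (γ α β : Fin (d + 1)) :
    ∑ v ∈ box (d + 1) (Lc ^ (k + 1)), (if toSite v γ % ((Lc ^ (k + 1) : ℕ) : ℤ) = ((Lc ^ (k + 1) : ℕ) : ℤ) - 1 then (1 : ℝ) else 0) *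
        ∑' yw : Site (d + 1) × Site (d + 1),
          (if yw.1 α % ((Lc ^ (k + 1) : ℕ) : ℤ) = ((Lc ^ (k + 1) : ℕ) : ℤ) - 1 then (1 : ℝ) else 0) *
            (if yw.2 β % ((Lc ^ (k + 1) : ℕ) : ℤ) = ((Lc ^ (k + 1) : ℕ) : ℤ) - 1 then (1 : ℝ) else 0) *
            ScombOf (symTablesAn1S2 d Lc cΛt) cE cVH cΛ 0 γ (toSite v) yw.1 yw.2 (Sum.inl α) (Sum.inl β) = 0 := by
  set w2 : Site (d + 1) × Site (d + 1) → ℝ := fun yw =>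
    (if yw.1 α % ((Lc ^ (k + 1) : ℕ) : ℤ) = ((Lc ^ (k + 1) : ℕ) : ℤ) - 1 then (1 : ℝ) else 0) *
      (if yw.2 β % ((Lc ^ (k + 1) : ℕ) : ℤ) = ((Lc ^ (k + 1) : ℕ) : ℤ) - 1 then (1 : ℝ) else 0) with hw2
  have hw2b : ∀ yw, |w2 yw| ≤ 1 := by
    intro yw; simp only [hw2]; split_ifs <;> simp
  -- local-stencil data: the cubic Wilson table and the level-0 Λ-piece at an1's record
  have h1 : LocStencil (wilsonA d) (wBound d * Real.exp (4 * 1)) 1 := locStencil_wilsonA zero_le_one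
  obtain ⟨CL, δL, hδL, hL⟩ := exists_locStencil_lamSectorOf_of_tables (d := d) (Lc := Lc) (symTablesAn1S2 d Lc cΛt).hH
  have hL' : LocStencil (SLam Lc (lamCoeffOf (KInv (N := Lc) (d := d)) Lc) (fun μ y => symHessFFAt (ctr (d + 1) Lc) Lc μ y)) CL δL := hL
  have key : ∀ v : Fin (d + 1) → ℕ,
      (∑' yw : Site (d + 1) × Site (d + 1), w2 yw * ScombOf (symTablesAn1S2 d Lc cΛt) cE cVH cΛ 0 γ (toSite v) yw.1 yw.2 (Sum.inl α) (Sum.inl β))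
        = cE * (∑' yw : Site (d + 1) × Site (d + 1), w2 yw * wilsonA d γ (toSite v) yw.1 yw.2 (Sum.inl α) (Sum.inl β))
          + cΛ * (∑' yw : Site (d + 1) × Site (d + 1),
            w2 yw * SLam Lc (lamCoeffOf (KInv (N := Lc) (d := d)) Lc) (fun μ y => symHessFFAt (ctr (d + 1) Lc) Lc μ y)
              γ (toSite v) yw.1 yw.2 (Sum.inl α) (Sum.inl β)) := by
    intro v
    have hsW := summable_weighted_pairs (h1 γ (toSite v)) one_pos (Sum.inl α) (Sum.inl β) w2 hw2b
    have hsL := summable_weighted_pairs (hL' γ (toSite v)) hδL (Sum.inl α) (Sum.inl β) w2 hw2b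
    have hpt : ∀ yw : Site (d + 1) × Site (d + 1),
        w2 yw * ScombOf (symTablesAn1S2 d Lc cΛt) cE cVH cΛ 0 γ (toSite v) yw.1 yw.2 (Sum.inl α) (Sum.inl β)
          = cE * (w2 yw * wilsonA d γ (toSite v) yw.1 yw.2 (Sum.inl α) (Sum.inl β))
            + cΛ * (w2 yw * SLam Lc (lamCoeffOf (KInv (N := Lc) (d := d)) Lc) (fun μ y => symHessFFAt (ctr (d + 1) Lc) Lc μ y)
              γ (toSite v) yw.1 yw.2 (Sum.inl α) (Sum.inl β)) := by
      intro yw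
      rw [ScombOf_eq, SrecOf_zero]
      simp only [S0NOf, Pi.add_apply, Pi.smul_apply, smul_eq_mul, symTablesAn1S2_V, symTablesAn1S2_H, symVhSAt_inl_inl, mul_zero, add_zero]
      ring
    rw [tsum_congr hpt, (hsW.mul_left cE).tsum_add (hsL.mul_left cΛ), tsum_mul_left, tsum_mul_left]
  have hU := threeFace_SLam_lamCoeffOf_sym_eq_zero (d := d) hLo k γ α β
  have hWk := threeFace_wilsonA (d := d) hLc3 k γ α β
  simp only [hw2] at key
  rw [Finset.sum_congr rfl fun v _ => by rw [key v]]
  simp only [mul_add, Finset.sum_add_distrib]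
  have hc : ∀ (a : ℝ) (F : (Fin (d + 1) → ℕ) → ℝ) (G : (Fin (d + 1) → ℕ) → ℝ),
      ∑ v ∈ box (d + 1) (Lc ^ (k + 1)), F v * (a * G v) = a * ∑ v ∈ box (d + 1) (Lc ^ (k + 1)), F v * G v := by
    intro a F G; rw [Finset.mul_sum]; exact Finset.sum_congr rfl fun v _ => by ring
  rw [hc cE, hc cΛ, hWk, hU, mul_zero, mul_zero, add_zero]

/-! ## §3 «3F-REC» at the comb: every level, every period; the transported member -/

/-- NOT IN PRINT; OUR BOOKKEEPING ([folklore]; **«3F-REC» AT THE COMB DATA**).  At an1's record with `Lc` odd and `3 ≤ Lc`, for ALL pins `cE cVH cΛ`, EVERY `j`, EVERY `k` and all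
`(γ, α, β)`: the three-face-legs cell form with period-`Lc^{k+1}` exit faces of the comb member `ScombOf tabs cE cVH cΛ j` VANISHES (induction on `j`, the period multiplied by `Lc` at
each step: §1 ⨾ §2 ⨾ the sym (T-H)_face). -/
theorem threeFace_ScombOf_rec (hLo : Odd Lc) (hLc3 : 3 ≤ Lc) (cΛt cE cVH cΛ : ℝ) :
    ∀ (j k : ℕ) (γ α β : Fin (d + 1)),
      ∑ v ∈ box (d + 1) (Lc ^ (k + 1)), (if toSite v γ % ((Lc ^ (k + 1) : ℕ) : ℤ) = ((Lc ^ (k + 1) : ℕ) : ℤ) - 1 then (1 : ℝ) else 0) *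
          ∑' yw : Site (d + 1) × Site (d + 1),
            (if yw.1 α % ((Lc ^ (k + 1) : ℕ) : ℤ) = ((Lc ^ (k + 1) : ℕ) : ℤ) - 1 then (1 : ℝ) else 0) *
              (if yw.2 β % ((Lc ^ (k + 1) : ℕ) : ℤ) = ((Lc ^ (k + 1) : ℕ) : ℤ) - 1 then (1 : ℝ) else 0) *
              ScombOf (symTablesAn1S2 d Lc cΛt) cE cVH cΛ j γ (toSite v) yw.1 yw.2 (Sum.inl α) (Sum.inl β) = 0 := by
  intro j
  induction j with
  | zero => exact fun k γ α β => threeFace_ScombOf_zero hLo hLc3 cΛt cE cVH cΛ k γ α β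
  | succ j ih =>
    intro k γ α β
    haveI : NeZero (Lc ^ (k + 1)) := ⟨pow_ne_zero _ (NeZero.ne Lc)⟩
    have e : Lc * Lc ^ (k + 1) = Lc ^ (k + 1 + 1) := (pow_succ' Lc (k + 1)).symm
    rw [threeFace_ScombOf_succ_unroll cΛt cE cVH cΛ j γ α β (Lc ^ (k + 1)), e, ih (k + 1) γ α β, threeFace_SLam_lamCoeffK_sym_eq_zero hLo j k γ α β]
    ring

/-- NOT IN PRINT; OUR BOOKKEEPING ([folklore]; period `Lc`). -/
theorem threeFace_ScombOf_rec_Lc (hLo : Odd Lc) (hLc3 : 3 ≤ Lc) (cΛt cE cVH cΛ : ℝ) (j : ℕ) (γ α β : Fin (d + 1)) :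
    ∑ v ∈ box (d + 1) Lc, (if toSite v γ % (Lc : ℤ) = (Lc : ℤ) - 1 then (1 : ℝ) else 0) *
        ∑' yw : Site (d + 1) × Site (d + 1),
          (if yw.1 α % (Lc : ℤ) = (Lc : ℤ) - 1 then (1 : ℝ) else 0) * (if yw.2 β % (Lc : ℤ) = (Lc : ℤ) - 1 then (1 : ℝ) else 0) *
            ScombOf (symTablesAn1S2 d Lc cΛt) cE cVH cΛ j γ (toSite v) yw.1 yw.2 (Sum.inl α) (Sum.inl β) = 0 := by
  have h := threeFace_ScombOf_rec (d := d) hLo hLc3 cΛt cE cVH cΛ j 0 γ α β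
  simpa only [zero_add, pow_one] using h

/-- NOT IN PRINT; OUR BOOKKEEPING ([folklore]; **THE TRANSPORTED MEMBER**).  The same for `𝒯 S̃comb_j = Ψ̂_Sᵀ ∘ slotPsiS (ScombOf tabs cE cVH cΛ j) ∘ Ψ̂_S` at every period `Lc^{k+1}`
(`ExitFaceWeightTransport.threeFace_transport_eq` ⨾ `threeFace_ScombOf_rec`). -/
theorem threeFace_transport_ScombOf_rec (hLo : Odd Lc) (hLc3 : 3 ≤ Lc) (cΛt cE cVH cΛ : ℝ) (j k : ℕ) (γ α β : Fin (d + 1)) :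
    ∑ v ∈ box (d + 1) (Lc ^ (k + 1)), (if toSite v γ % ((Lc ^ (k + 1) : ℕ) : ℤ) = ((Lc ^ (k + 1) : ℕ) : ℤ) - 1 then (1 : ℝ) else 0) *
        ∑' yw : Site (d + 1) × Site (d + 1),
          (if yw.1 α % ((Lc ^ (k + 1) : ℕ) : ℤ) = ((Lc ^ (k + 1) : ℕ) : ℤ) - 1 then (1 : ℝ) else 0) *
            (if yw.2 β % ((Lc ^ (k + 1) : ℕ) : ℤ) = ((Lc ^ (k + 1) : ℕ) : ℤ) - 1 then (1 : ℝ) else 0) *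
            comp (comp (trK (psiKS (ctrOff (d + 1) Lc) Lc)) (slotPsiS (ctrOff (d + 1) Lc) Lc (ScombOf (symTablesAn1S2 d Lc cΛt) cE cVH cΛ j) γ (toSite v))) (psiKS (ctrOff (d + 1) Lc) Lc)
              yw.1 yw.2 (Sum.inl α) (Sum.inl β) = 0 := by
  obtain ⟨Cs, δs, hδs, hS⟩ := locStencil_ScombOf (symTablesAn1S2 d Lc cΛt) cE cVH cΛ j
  have e : Lc ^ (k + 1) = Lc * Lc ^ k := pow_succ' Lc k
  rw [e, threeFace_transport_eq (pos_Lc (Lc := Lc)) (ctrOff_mem_box (pos_Lc (Lc := Lc))) hS hδs (Lc ^ k) γ α β, ← e]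
  exact threeFace_ScombOf_rec hLo hLc3 cΛt cE cVH cΛ j k γ α β

end Summit.QuantumFields.BalabanUV.Beta.GAN24.CombThreeFaceRec

end
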